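import Summits.CriticalPhenomena.SAWScalingLimit.Theses.SAWWeldingIdentification
import Summits.CriticalPhenomena.SAWScalingLimit.Theorems.SAWRenewalTightnessTightOfShellCrossing
import Literature.Probability.RandomPlanarGeometry.CurvePVariation
import HarnessLib

/-!
# `EventualTight` from tightness of the `p`-variation (strategist s3-B controlling-quantity rung)

Crux stmt-CriticalPhenomena-1372 `EventualTight` (shared decl of `SAWRenewalTightness` /
`SAWWeldingIdentification`), line `Sketch`: the strategist s3-B rung
`PVariationTight p → EventualTight`, landed as a supporting theorem with the hypothesis inlined.

Tightness of ONE functional of the pushed critical SAW polyline — its `p`-variation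
`Curve.pVariation p` — gives precompactness of the pushed-forward laws
`{(law D δ a_δ b_δ).map curve : δ ∈ (0, δ₀]}` on `CurveClass ℂ`, because the compact sets are the
closures of `{range ⊆ Λ, V_p ≤ M}` (`CurveClass.isCompact_closure_image_mk_of_pVariation_le`,
Aizenman–Burchard Lemma 4.1 through the tortuosity bound `M(γ, 2ℓ) ≤ V_p/ℓ^p + 1`), with `Λ` a
closed disc containing the domain and the unit disc about the first marked point (the lattice
start `a_δ` may lie off `Ω̄`, but is within `1` of `D.pt 0` for small `δ` by the endpoint
approximation; ranges are controlled by `Theorems.range_toCurve_domainSAW_subset` and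
`Theorems.mem_meshDomain_of_mem_tail_support`, exactly as in `TightOfShellCrossing_proof`).

* `eventualTight_of_pVariationTight` — the rung for the welding-route copy
  `SAWWeldingIdentification.EventualTight` (the registered stub signature, verbatim);
* `eventualTight_renewal_of_pVariationTight` — the same for the renewal-route copy
  `SAWRenewalTightness.EventualTight` (the two copies are definitionally equal).

[cite: AizenmanBurchardDuke1999, Lemma 4.1]
-/

noncomputable section

open MeasureTheory Filter Topology Set Metric
open scoped ENNReal NNReal unitInterval
open Literature.Probability.RandomPlanarGeometry Literature.Probability.LatticeModels

namespace Summit.CriticalPhenomena.SAWScalingLimit.Theorems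

/-- **`PVariationTight p → EventualTight`** (welding-route copy of the shared crux
stmt-CriticalPhenomena-1372, by name): if for every Dobrushin domain and endpoint approximation the
`p`-variation `V_p` of the pushed critical SAW polyline is a tight random variable uniformly in
`δ ∈ (0, δ₀]` (for every `θ > 0` some level `M ≥ 0` has `P_δ[V_p(γ_δ) > M] ≤ θ`), then the
pushed-forward laws are eventually tight.  The compact sets are the closures of
`{range ⊆ Λ, V_p ≤ M}` (`CurveClass.isCompact_closure_image_mk_of_pVariation_le`, AB99 Lemma 4.1
through `M(γ, 2ℓ) ≤ V_p/ℓ^p + 1`), with `Λ` a closed disc containing the domain and the unit disc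
about the first marked point (the lattice start `a_δ` may lie off `Ω̄`; it is within `1` of `D.pt 0`
for small `δ` by the endpoint approximation, exactly as in `TightOfShellCrossing_proof`).
[cite: AizenmanBurchardDuke1999, Lemma 4.1] -/
theorem eventualTight_of_pVariationTight :
    ∀ {p : ℝ}, 0 ≤ p →
    (∀ (D : DobrushinDomain) (a b : ℝ → Site 2), SAW.IsEndpointApprox D a b →
      ∃ δ₀ : ℝ, 0 < δ₀ ∧ ∀ θ : ℝ, 0 < θ → ∃ M : ℝ, 0 ≤ M ∧ ∀ δ ∈ Set.Ioc (0 : ℝ) δ₀,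
        SAW.law D.carrier δ (a δ) (b δ)
          {γ | ENNReal.ofReal M < (⟨γ.walk.toCurve (meshPoint δ)⟩ : Curve ℂ).pVariation p} ≤
          ENNReal.ofReal θ) →
    Summit.CriticalPhenomena.SAWScalingLimit.Theses.SAWWeldingIdentification.EventualTight :=
  fun {p} hp hV => by
  intro D a b hab
  classical
  obtain ⟨δ₁, hδ₁, hM⟩ := hV D a b hab
  -- the endpoint `a_δ` is within `1` of the marked point `a` for small `δ`
  have hnear : ∀ᶠ δ in 𝓝[>] (0 : ℝ), meshPoint δ (a δ) ∈ ball (D.pt 0) 1 :=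
    hab.tendsto_fst.eventually_mem (ball_mem_nhds _ one_pos)
  obtain ⟨δ₂, hδ₂, hsub₂⟩ := mem_nhdsGT_iff_exists_Ioo_subset.1 hnear
  have hδ₂' : (0 : ℝ) < δ₂ := hδ₂
  -- a disc containing the domain and the unit disc about `a`
  obtain ⟨r, hr⟩ := D.isBounded.subset_closedBall (0 : ℂ)
  set rΛ : ℝ := max r 0 + ‖D.pt 0‖ + 1 with hrΛ
  have hΩ : D.carrier ⊆ closedBall (0 : ℂ) rΛ := hr.trans (closedBall_subset_closedBall (by
    rw [hrΛ]; linarith [le_max_left r 0, norm_nonneg (D.pt 0)]))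
  have hball : ball (D.pt 0) 1 ⊆ closedBall (0 : ℂ) rΛ := by
    intro z hz
    rw [mem_ball] at hz
    rw [mem_closedBall, dist_zero_right]
    have := norm_le_norm_add_norm_sub' z (D.pt 0)
    rw [← dist_eq_norm] at this
    rw [hrΛ]
    linarith [le_max_right r 0]
  -- the mesh threshold
  set δ₀ : ℝ := min δ₁ (δ₂ / 2) with hδ₀
  have hδ₀pos : 0 < δ₀ := lt_min hδ₁ (half_pos hδ₂')
  have hδ₀δ₁ : δ₀ ≤ δ₁ := min_le_left _ _
  have hδ₀δ₂ : δ₀ < δ₂ := (min_le_right _ _).trans_lt (half_lt_self hδ₂')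
  refine ⟨δ₀, hδ₀pos, ?_⟩
  -- ranges lie in the disc for `δ ∈ (0, δ₀]`
  have hrange : ∀ δ ∈ Set.Ioc (0 : ℝ) δ₀, ∀ γ : SAW.DomainSAW D.carrier δ (a δ) (b δ),
      (⟨γ.walk.toCurve (meshPoint δ)⟩ : Curve ℂ).range ⊆ closedBall 0 rΛ := by
    intro δ hδ γ
    refine Theorems.range_toCurve_domainSAW_subset γ fun q hq ↦ ?_
    rw [SimpleGraph.Walk.mem_support_iff] at hq
    rcases hq with rfl | hq
    · exact hball (hsub₂ ⟨hδ.1, hδ.2.trans_lt hδ₀δ₂⟩)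
    · exact hΩ (meshDomain_subset_meshVertices _ _
        (Theorems.mem_meshDomain_of_mem_tail_support γ.walk q hq))
  -- tightness: for `ε`, the compact set `closure (mk '' {range ⊆ Λ, V_p ≤ M(ε)})`
  rw [isTightMeasureSet_iff_exists_isCompact_measure_compl_le]
  intro ε hε
  rcases eq_or_ne ε ⊤ with rfl | hεtop
  · exact ⟨∅, isCompact_empty, fun μ _ ↦ le_top⟩
  have hεr : 0 < ε.toReal := ENNReal.toReal_pos hε.ne' hεtop
  obtain ⟨M, -, hMbound⟩ := hM ε.toReal hεr
  set 𝒦 : Set (Curve ℂ) :=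
    {γ | γ.range ⊆ closedBall (0 : ℂ) rΛ ∧ γ.pVariation p ≤ ENNReal.ofReal M} with h𝒦
  have h𝒦c : IsCompact (closure (CurveClass.mk '' 𝒦)) :=
    CurveClass.isCompact_closure_image_mk_of_pVariation_le (E := ℂ)
      (isCompact_closedBall (0 : ℂ) rΛ) hp (M := ENNReal.ofReal M) ENNReal.ofReal_ne_top
  refine ⟨closure (CurveClass.mk '' 𝒦), h𝒦c, ?_⟩
  rintro μ ⟨δ, hδ, rfl⟩
  have hmeas : Measurable fun γ : SAW.DomainSAW D.carrier δ (a δ) (b δ) ↦ γ.curve :=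
    SAW.DomainSAW.measurable_of_top _
  rw [Measure.map_apply hmeas h𝒦c.isClosed.measurableSet.compl]
  calc SAW.law D.carrier δ (a δ) (b δ) ((fun γ ↦ γ.curve) ⁻¹' (closure (CurveClass.mk '' 𝒦))ᶜ)
      ≤ SAW.law D.carrier δ (a δ) (b δ)
          {γ | ENNReal.ofReal M < (⟨γ.walk.toCurve (meshPoint δ)⟩ : Curve ℂ).pVariation p} := by
        refine measure_mono fun γ hγ ↦ ?_
        simp only [mem_preimage, mem_compl_iff] at hγ
        simp only [mem_setOf_eq]
        by_contra hle
        exact hγ (subset_closure ⟨_, ⟨hrange δ hδ γ, not_lt.1 hle⟩, rfl⟩)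
    _ ≤ ENNReal.ofReal ε.toReal := hMbound δ ⟨hδ.1, hδ.2.trans hδ₀δ₁⟩
    _ = ε := ENNReal.ofReal_toReal hεtop

/-- **`PVariationTight p → EventualTight`, renewal-route copy**: the two route copies of the shared
crux stmt-CriticalPhenomena-1372 (`SAWWeldingIdentification.EventualTight` and
`SAWRenewalTightness.EventualTight`) are definitionally equal, so
`eventualTight_of_pVariationTight` is also the `SAWRenewalTightness` statement.
[cite: AizenmanBurchardDuke1999, Lemma 4.1] -/
theorem eventualTight_renewal_of_pVariationTight {p : ℝ} (hp : 0 ≤ p)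
    (hV : ∀ (D : DobrushinDomain) (a b : ℝ → Site 2), SAW.IsEndpointApprox D a b →
      ∃ δ₀ : ℝ, 0 < δ₀ ∧ ∀ θ : ℝ, 0 < θ → ∃ M : ℝ, 0 ≤ M ∧ ∀ δ ∈ Set.Ioc (0 : ℝ) δ₀,
        SAW.law D.carrier δ (a δ) (b δ)
          {γ | ENNReal.ofReal M < (⟨γ.walk.toCurve (meshPoint δ)⟩ : Curve ℂ).pVariation p} ≤
          ENNReal.ofReal θ) :
    Summit.CriticalPhenomena.SAWScalingLimit.Theses.SAWRenewalTightness.EventualTight :=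
  eventualTight_of_pVariationTight hp hV

end Summit.CriticalPhenomena.SAWScalingLimit.Theorems

end
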